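import Mathlib.Analysis.Convex.Topology
import Mathlib.Topology.MetricSpace.HausdorffDistance
import Literature.Probability.LatticeModels.MedialInterfaceProofs
import Literature.Probability.Percolation.BoxCrossingProofs
import HarnessLib

/-!
# Discrete boundary sites are strictly `2δ`-close to `∂Ω`: stub
`stub_kernel_zdBoundary_near_frontier` (K1) of line `hitting-tournament` for crux `LagHandOff`
(stmt-CriticalPhenomena-10268)

The metric brick of the contact kernel of seat c5.  For discrete Dobrushin data `E` with positive
mesh `δ` and OPEN domain `Ω`, every site `z` of the square-lattice discrete boundary
`E.zdBoundary = meshBoundary Ω δ ∪ {x | ∃ y, E.IsFaceBoundaryEdge x y}`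
(`Literature/Probability/LatticeModels/MedialInterface.lean`) satisfies
`infDist (δz) (frontier Ω) < 2δ`.

Proof.

* `z ∈ meshBoundary Ω δ`: by `infDist_frontier_le_of_mem_meshBoundary`
  (`Literature/Probability/Percolation/BoxCrossingProofs.lean`) the distance is `≤ |δ| = δ < 2δ`.
* `z` an endpoint of a face-boundary edge: `z ∈ Ω_δ` corners a NON-inner face `f`, and it
  suffices to produce a point of `∂Ω` on a segment joining two corners of `f`: such a point lies
  in the closed mesh square of `f`, whose points are within `δ√2 < 2δ` of the corner `δz`
  (`dist_lt_of_mem_segment`, done in coordinates without `√2`: both coordinate offsets are at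
  most `δ`, so the squared distance is at most `2δ² < 4δ²`).  The basic mechanism
  (`exists_frontier_of_not_adj`): if `a ∈ Ω_δ` and a lattice neighbour `b` is not `Ω_δ`-adjacent
  to `a`, the closed mesh edge `[δa, δb]` meets `∂Ω` — otherwise it lies in the open set `Ω` (a
  segment from a point of `Ω` missing `∂Ω` stays in `Ω`, `exists_mem_segment_frontier`), so it is
  a mesh edge and `δb ∈ Ω`, whence `b ∈ Ω_δ` (the discrete domain is a union of mesh components,
  `mem_meshDomain_of_meshGraph_adj`) and `a ∼ b` in `Ω_δ`.  The non-inner face `f` has two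
  lattice-adjacent corners `v`, `w` not `Ω_δ`-adjacent.  If `v ∈ Ω_δ`, apply the mechanism to
  `(v, w)`.  Otherwise let `u` be the corner of `f` with the abscissa of `v` and the ordinate of
  `z`; corners agreeing in a coordinate coincide or are lattice neighbours
  (`eq_or_adj_of_apply_zero_eq`, `eq_or_adj_of_apply_one_eq`).  If `u ∈ Ω_δ` then `u ≠ v` and
  the mechanism applies to `(u, v)`; if `u ∉ Ω_δ` then `z ≠ u` and it applies to `(z, u)`.

Only definitions and lemmas of `DomainDiscretisation.lean`, `MedialInterface.lean`,
`DobrushinInterfaceExistence.lean` (`isCorner_iff`, `zdGraph_two_adj_iff_add`, `Site.ext_two`),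
`BoxCrossingProofs.lean` and Mathlib's metric / convexity API are used.  Helpers live in the
sub-namespace `KernelBoundaryNear`.
-/

noncomputable section

open Set Metric
open Literature.Probability.Percolation Literature.Probability.LatticeModels
open Literature.Probability.RandomPlanarGeometry

namespace Summit.CriticalPhenomena.CardyFormulaZ2.Cruxes.LagHandOff.HittingTournament

namespace KernelBoundaryNear

variable {Ω : Set ℂ} {δ : ℝ}

/-! ### The basic mechanism -/

/-- **The basic mechanism.** If `a ∈ Ω_δ` and a lattice neighbour `b` of `a` is not joined to `a`
in `Ω_δ`, then the closed mesh edge `[δa, δb]` meets `∂Ω` (for `Ω` open): otherwise it lies in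
`Ω`, so it is a mesh edge ending at a mesh vertex, `b ∈ Ω_δ`, and `a ∼ b` in `Ω_δ`. -/
theorem exists_frontier_of_not_adj (hΩ : IsOpen Ω) {a b : Site 2} (ha : a ∈ meshDomain Ω δ)
    (hab : (zdGraph 2).Adj a b) (hn : ¬ (discreteDomainGraph Ω δ).Adj a b) :
    ∃ w ∈ segment ℝ (meshPoint δ a) (meshPoint δ b), w ∈ frontier Ω := by
  refine exists_mem_segment_frontier hΩ (meshDomain_subset_meshVertices Ω δ ha) fun hseg => hn ?_
  have hadj : (meshGraph Ω δ).Adj a b := meshGraph_adj_iff.2 ⟨hab, hseg.trans subset_closure⟩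
  exact discreteDomainGraph_adj_iff.2
    ⟨hadj, ha, mem_meshDomain_of_meshGraph_adj ha (hseg (right_mem_segment ℝ _ _)) hadj⟩

/-! ### Faces of `ℤ²`: corners in coordinates -/

/-- Two corners of a face with the same ordinate coincide or are lattice neighbours. -/
theorem eq_or_adj_of_apply_one_eq {a b f : Site 2} (ha : IsCorner a f) (hb : IsCorner b f)
    (h : a 1 = b 1) : a = b ∨ (zdGraph 2).Adj a b := by
  rcases ha 0 with h0 | h0 <;> rcases hb 0 with h0' | h0'
  · exact Or.inl (Site.ext_two (h0.trans h0'.symm) h)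
  · refine Or.inr ((zdGraph_two_adj_iff_add a b).2 (Or.inl (Site.ext_two ?_ ?_))) <;>
      simp [h0, h0', h]
  · refine Or.inr ((zdGraph_two_adj_iff_add a b).2 (Or.inr (Or.inr (Or.inl (Site.ext_two ?_ ?_)))))
      <;> simp [h0, h0', h]
  · exact Or.inl (Site.ext_two (h0.trans h0'.symm) h)

/-- Two corners of a face with the same abscissa coincide or are lattice neighbours. -/
theorem eq_or_adj_of_apply_zero_eq {a b f : Site 2} (ha : IsCorner a f) (hb : IsCorner b f)
    (h : a 0 = b 0) : a = b ∨ (zdGraph 2).Adj a b := by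
  rcases ha 1 with h1 | h1 <;> rcases hb 1 with h1' | h1'
  · exact Or.inl (Site.ext_two h (h1.trans h1'.symm))
  · refine Or.inr ((zdGraph_two_adj_iff_add a b).2 (Or.inr (Or.inl (Site.ext_two ?_ ?_)))) <;>
      simp [h1, h1', h]
  · refine Or.inr ((zdGraph_two_adj_iff_add a b).2 (Or.inr (Or.inr (Or.inr (Site.ext_two ?_ ?_)))))
      <;> simp [h1, h1', h]
  · exact Or.inl (Site.ext_two h (h1.trans h1'.symm))

/-! ### Distances inside a closed mesh square -/

/-- Two corners of a face have coordinates differing by at most one. -/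
theorem abs_cast_sub_cast_le_one {a z f : Site 2} (ha : IsCorner a f) (hz : IsCorner z f)
    (i : Fin 2) : |((a i : ℤ) : ℝ) - (z i : ℝ)| ≤ 1 := by
  rcases ha i with h | h <;> rcases hz i with h' | h' <;> rw [h, h', abs_le] <;> push_cast <;>
    constructor <;> linarith

/-- The mesh points of two corners of a face have real parts within `δ` of each other. -/
theorem abs_re_sub_re_le (hδ : 0 ≤ δ) {a z f : Site 2} (ha : IsCorner a f) (hz : IsCorner z f) :
    |(meshPoint δ a).re - (meshPoint δ z).re| ≤ δ := by
  rw [meshPoint_re, meshPoint_re, ← mul_sub, abs_mul, abs_of_nonneg hδ]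
  exact mul_le_of_le_one_right hδ (abs_cast_sub_cast_le_one ha hz 0)

/-- The mesh points of two corners of a face have imaginary parts within `δ` of each other. -/
theorem abs_im_sub_im_le (hδ : 0 ≤ δ) {a z f : Site 2} (ha : IsCorner a f) (hz : IsCorner z f) :
    |(meshPoint δ a).im - (meshPoint δ z).im| ≤ δ := by
  rw [meshPoint_im, meshPoint_im, ← mul_sub, abs_mul, abs_of_nonneg hδ]
  exact mul_le_of_le_one_right hδ (abs_cast_sub_cast_le_one ha hz 1)

/-- A convex combination of two reals within `δ` of `c` is within `δ` of `c`. -/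
theorem abs_convex_comb_sub_le {s t x y c δ : ℝ} (hs : 0 ≤ s) (ht : 0 ≤ t) (hst : s + t = 1)
    (hx : |x - c| ≤ δ) (hy : |y - c| ≤ δ) : |s * x + t * y - c| ≤ δ := by
  have e : s * x + t * y - c = s * (x - c) + t * (y - c) := by linear_combination c * hst
  rw [e]
  calc |s * (x - c) + t * (y - c)| ≤ |s * (x - c)| + |t * (y - c)| := abs_add_le _ _
    _ = s * |x - c| + t * |y - c| := by rw [abs_mul, abs_mul, abs_of_nonneg hs, abs_of_nonneg ht]
    _ ≤ s * δ + t * δ := by gcongr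
    _ = δ := by rw [← add_mul, hst, one_mul]

/-- **Points of a closed mesh square are strictly `2δ`-close to its corners.** A point of a
segment joining (the mesh points of) two corners `a`, `b` of a face `f` is at distance `< 2δ`
from the mesh point of any corner `z` of `f` (both coordinate offsets are `≤ δ`, so the squared
distance is `≤ 2δ² < 4δ²`; `δ > 0`). -/
theorem dist_lt_of_mem_segment (hδ : 0 < δ) {z a b f : Site 2} (hz : IsCorner z f)
    (ha : IsCorner a f) (hb : IsCorner b f) {p : ℂ}
    (hp : p ∈ segment ℝ (meshPoint δ a) (meshPoint δ b)) : dist (meshPoint δ z) p < 2 * δ := by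
  obtain ⟨s, t, hs, ht, hst, rfl⟩ := hp
  have hre : |(s • meshPoint δ a + t • meshPoint δ b).re - (meshPoint δ z).re| ≤ δ := by
    simpa only [Complex.add_re, Complex.smul_re, smul_eq_mul] using
      abs_convex_comb_sub_le hs ht hst (abs_re_sub_re_le hδ.le ha hz) (abs_re_sub_re_le hδ.le hb hz)
  have him : |(s • meshPoint δ a + t • meshPoint δ b).im - (meshPoint δ z).im| ≤ δ := by
    simpa only [Complex.add_im, Complex.smul_im, smul_eq_mul] using
      abs_convex_comb_sub_le hs ht hst (abs_im_sub_im_le hδ.le ha hz) (abs_im_sub_im_le hδ.le hb hz)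
  rw [dist_comm, Complex.dist_eq_re_im, Real.sqrt_lt' (by positivity)]
  have h1 := sq_le_sq' (abs_le.1 hre).1 (abs_le.1 hre).2
  have h2 := sq_le_sq' (abs_le.1 him).1 (abs_le.1 him).2
  nlinarith [mul_pos hδ hδ]

end KernelBoundaryNear

open KernelBoundaryNear in
/-- **K1 `stub_kernel_zdBoundary_near_frontier`.** Every site of the square-lattice discrete
boundary `E.zdBoundary` of discrete Dobrushin data with positive mesh and open domain lies
strictly within `2δ` of the topological frontier of the domain: a `meshBoundary` site has a
lattice neighbour not joined to it in `Ω_δ`, so the corresponding closed mesh edge meets `∂Ω`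
(within `|δ| = δ < 2δ`); an endpoint of a face-boundary edge is a corner of a non-inner face,
inside whose closed mesh square (all of whose points are within `δ√2 < 2δ` of the corner) the
same mechanism produces a point of `∂Ω` on one of the sides. -/
theorem stub_kernel_zdBoundary_near_frontier :
    ∀ (E : DiscreteDobrushin), 0 < E.δ → IsOpen E.Ω →
      ∀ z ∈ E.zdBoundary, Metric.infDist (meshPoint E.δ z) (frontier E.Ω) < 2 * E.δ := by
  intro E hδ hΩ z hz
  rcases E.mem_zdBoundary_iff.1 hz with hzb | ⟨y, hzy, -, f, hf, hzf, -⟩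
  · -- `z ∈ meshBoundary Ω δ`: within `|δ|` of the frontier
    refine (infDist_frontier_le_of_mem_meshBoundary hΩ hzb).trans_lt ?_
    rw [abs_of_pos hδ]
    linarith
  · -- `z` is an endpoint of a face-boundary edge: a corner of the non-inner face `f`;
    -- it suffices to find a frontier point on a segment between two corners of `f`
    suffices h : ∃ a b : Site 2, IsCorner a f ∧ IsCorner b f ∧
        ∃ w ∈ segment ℝ (meshPoint E.δ a) (meshPoint E.δ b), w ∈ frontier E.Ω by
      obtain ⟨a, b, haf, hbf, w, hw, hwf⟩ := h
      exact (infDist_le_dist_of_mem hwf).trans_lt (dist_lt_of_mem_segment hδ hzf haf hbf hw)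
    have hzD : z ∈ meshDomain E.Ω E.δ := (discreteDomainGraph_adj_iff.1 hzy).2.1
    have key : ∀ a b : Site 2, IsCorner a f → IsCorner b f → a ∈ meshDomain E.Ω E.δ →
        (zdGraph 2).Adj a b → ¬ (discreteDomainGraph E.Ω E.δ).Adj a b →
        ∃ a b : Site 2, IsCorner a f ∧ IsCorner b f ∧
          ∃ w ∈ segment ℝ (meshPoint E.δ a) (meshPoint E.δ b), w ∈ frontier E.Ω :=
      fun a b ha hb haD hab hn => ⟨a, b, ha, hb, exists_frontier_of_not_adj hΩ haD hab hn⟩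
    unfold DiscreteDobrushin.IsInnerFace at hf
    push Not at hf
    obtain ⟨v, w, hv, hw, hvw, hn⟩ := hf
    by_cases hvD : v ∈ meshDomain E.Ω E.δ
    · exact key v w hv hw hvD hvw hn
    · -- the corner `u` with the abscissa of `v` and the ordinate of `z`
      set u : Site 2 := ![v 0, z 1] with hu_def
      have hu0 : u 0 = v 0 := by simp [hu_def]
      have hu1 : u 1 = z 1 := by simp [hu_def]
      have hu : IsCorner u f := by
        rw [IsCorner, Fin.forall_fin_two, hu0, hu1]
        exact ⟨hv 0, hzf 1⟩
      by_cases huD : u ∈ meshDomain E.Ω E.δ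
      · -- `u ∈ Ω_δ`, `v ∉ Ω_δ`: the side `{u, v}` is not an `Ω_δ`-edge
        rcases eq_or_adj_of_apply_zero_eq hu hv hu0 with h | h
        · exact absurd huD (h ▸ hvD)
        · exact key u v hu hv huD h fun h' => hvD (discreteDomainGraph_adj_iff.1 h').2.2
      · -- `z ∈ Ω_δ`, `u ∉ Ω_δ`: the side `{z, u}` is not an `Ω_δ`-edge
        rcases eq_or_adj_of_apply_one_eq hzf hu hu1.symm with h | h
        · exact absurd hzD (h ▸ huD)
        · exact key z u hzf hu hzD h fun h' => huD (discreteDomainGraph_adj_iff.1 h').2.2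

end Summit.CriticalPhenomena.CardyFormulaZ2.Cruxes.LagHandOff.HittingTournament

end
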